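/-
Copyright (c) 2026 the pub-hodgecm-mathlib formalisation cell (harness21).  Prover seat hodgecm-mathlib-R90-C131-p02 (g0) (R90-TF S4 hand lent to L1
by CHAIR VALVE WORD W4), Track B «K2-LIT», hLiu418 = `stmt-HodgeConjecture-24832`; K1-a♮ line lead K2E5-p16 (g8) DESK NAME 01:27Z «(iii-b-3)», FILE 2a.
THEOREMS ONLY (no `def`, no instance, no notation, no named-fact hypothesis, no `sorry`); lane `--supports stmt-HodgeConjecture-24832 --as helper`.
-/
import Summits.HodgeConjecture.HodgeConjecture.Theorems.K2LiuArchTwistedScalarBlockParamSmooth   -- ★ p863550 (ii): the universal witness `Φ` with (a)–(d)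
import Mathlib.Analysis.SpecialFunctions.Pow.Deriv
import Mathlib.Analysis.Calculus.Deriv.ZPow
import HarnessLib

/-!
# Crux `HLiu418`, (Φ-S1) road B, (iii-b-3) FILE 2a: the three COMPOSITE-DERIVATIVE LETTERS of the ray derivative of the explicit scalar letter —
# `t ↦ (r(t) : ℂ)^c` (real positive base), `t ↦ f(t)^m` (`m : ℤ`, `f ≠ 0`), and `t ↦ Φ_N(α₀, β₀, p(t), s)` (★ p863550 (d) ∘ chain rule)

Cell `hodgecm-mathlib`, crux item hLiu418 = `stmt-HodgeConjecture-24832` (helper lane, count-neutral).  FILE 2b differentiates ★ p864004's explicit letter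
`Ac s (g·exp(tX))` in `t` at `0` by the product rule; its `s`-carrying `t`-dependent factors are `‖det d(t)‖^{k−2s−2}` and `(1/q′(t))^{2s}` (a positive
real differentiable base to a complex power), `det d(t)^{−k}` (an integer power of a non-vanishing complex differentiable function), and
`Φ_N(1+k/2, 1−k/2, p(t), s)` (the universal continuation witness at the moving weight parameter `p(t)`, ★ FILE 1 `differentiable_p`).  This file gives
the three derivative letters with EXPLICIT values (each visibly holomorphic in `s` where `s` enters):
* §1 `hasDerivAt_ofReal_cpow_const` — `d/dt (r t : ℂ)^c = c·(r t₀)^{c−1}·r′`;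
* §2 `hasDerivAt_zpow_comp` — `d/dt f(t)^m = m·f(t₀)^{m−1}·f′`;
* §3 `hasDerivAt_comp_weightParam` — `d/dt Φ α₀ β₀ (p t) s = p′·(−(β₀+s−1)·Φ α₀ (β₀+1) (p t₀) s)` on the strip `{1 − N < re(β₀+s)}`, and
  `differentiableOn_weightParamDeriv` — that value is holomorphic in `s` there (★ (ii)(a) at `β₀+1`).

HONEST LABEL: calculus letters; closes no socket.  HC_CM is proved only modulo the 7 printed citations (2 remaining named inputs: hLiu418 =
`stmt-HodgeConjecture-24832`, h413 = `stmt-HodgeConjecture-24833`) until rung 0 closes.  REL ≠ ★ ≠ BUILT.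

## References
* [Knapp1986] A. W. Knapp, *Representation Theory of Semisimple Groups*, Princeton (1986), Ch. VIII §3.
* [Shimura1982] G. Shimura, *Confluent hypergeometric functions on tube domains*, Math. Ann. 260 (1982), §3 Thm. 3.1.
-/

set_option autoImplicit false
set_option linter.dupNamespace false

noncomputable section

open Complex Set

namespace Summit.HodgeConjecture.HodgeConjecture.Cruxes.HLiu418.K2LiuArchRayDerivLetters

/-! ## §1 A positive real differentiable base to a complex power -/

/-- **`d/dt (r t : ℂ)^c = c·(r t₀ : ℂ)^{c−1}·r′`** for a real function `r` differentiable at `t₀` with `r t₀ > 0` and any `c : ℂ`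
(the `‖det d(t)‖^{k−2s−2}` and `(1/q′(t))^{2s}` factors of the explicit letter). [folklore] -/
theorem hasDerivAt_ofReal_cpow_const {r : ℝ → ℝ} {r' t₀ : ℝ} (hr : HasDerivAt r r' t₀) (hpos : 0 < r t₀) (c : ℂ) :
    HasDerivAt (fun t : ℝ => ((r t : ℝ) : ℂ) ^ c) (c * ((r t₀ : ℝ) : ℂ) ^ (c - 1) * ((r' : ℝ) : ℂ)) t₀ := by
  have h2 : HasDerivAt (fun z : ℂ => z ^ c) (c * ((r t₀ : ℝ) : ℂ) ^ (c - 1)) ((r t₀ : ℝ) : ℂ) :=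
    (Complex.hasStrictDerivAt_cpow_const (Complex.ofReal_mem_slitPlane.2 hpos)).hasDerivAt
  exact h2.comp t₀ hr.ofReal_comp

/-- The value `c·ρ^{c−1}·r′` is ENTIRE in the exponent `c` (`ρ > 0`); along an affine line `c = u·s + w` it is holomorphic in `s`. [folklore] -/
theorem differentiable_cpow_deriv_value {ρ : ℝ} (hρ : 0 < ρ) (r' : ℝ) (u w : ℂ) :
    Differentiable ℂ (fun s : ℂ => (u * s + w) * ((ρ : ℝ) : ℂ) ^ ((u * s + w) - 1) * ((r' : ℝ) : ℂ)) := by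
  have hρ0 : ((ρ : ℝ) : ℂ) ≠ 0 := by exact_mod_cast hρ.ne'
  have hlin : Differentiable ℂ (fun s : ℂ => u * s + w) := ((differentiable_id).const_mul u).add_const w
  exact (hlin.mul fun s => ((hlin.sub_const 1) s).const_cpow (Or.inl hρ0)).mul (differentiable_const _)

/-! ## §2 An integer power of a non-vanishing complex differentiable function -/

/-- **`d/dt f(t)^m = m·f(t₀)^{m−1}·f′`** for `f : ℝ → ℂ` differentiable at `t₀` with `f t₀ ≠ 0` (`m : ℤ`; the `det d(t)^{−k}` factor). [folklore] -/
theorem hasDerivAt_zpow_comp {f : ℝ → ℂ} {f' : ℂ} {t₀ : ℝ} (hf : HasDerivAt f f' t₀) (hne : f t₀ ≠ 0) (m : ℤ) :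
    HasDerivAt (fun t : ℝ => f t ^ m) ((m : ℂ) * f t₀ ^ (m - 1) * f') t₀ :=
  (hasDerivAt_zpow m (f t₀) (Or.inl hne)).comp t₀ hf

/-! ## §3 The continuation witness at the moving weight parameter -/

/-- **CHAIN RULE FOR THE CONTINUED LETTER AT A MOVING WEIGHT PARAMETER**: if `Φ` satisfies ★ (ii)(d) — `HasDerivAt (p ↦ Φ α₀ β₀ p s)
(−(β₀+s−1)·Φ α₀ (β₀+1) p s) p` for `p > 0` and `1 − N < re(β₀+s)` — and `p : ℝ → ℝ` has derivative `p′` at `t₀` with `p t₀ > 0`, then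
`t ↦ Φ α₀ β₀ (p t) s` has derivative `p′·(−(β₀+s−1)·Φ α₀ (β₀+1) (p t₀) s)` at `t₀`. [Shimura1982, §3 Thm. 3.1] -/
theorem hasDerivAt_comp_weightParam {N : ℕ} (Φ : ℂ → ℂ → ℝ → ℂ → ℂ)
    (hΦd : ∀ (α₀ β₀ : ℂ) (p : ℝ), 0 < p → ∀ s : ℂ, 1 - (N : ℝ) < (β₀ + s).re →
      HasDerivAt (fun p' : ℝ => Φ α₀ β₀ p' s) (-(β₀ + s - 1) * Φ α₀ (β₀ + 1) p s) p)
    (α₀ β₀ : ℂ) {p : ℝ → ℝ} {p' t₀ : ℝ} (hp : HasDerivAt p p' t₀) (hpos : 0 < p t₀) {s : ℂ} (hs : 1 - (N : ℝ) < (β₀ + s).re) :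
    HasDerivAt (fun t : ℝ => Φ α₀ β₀ (p t) s) (((p' : ℝ) : ℂ) * (-(β₀ + s - 1) * Φ α₀ (β₀ + 1) (p t₀) s)) t₀ := by
  have h := (hΦd α₀ β₀ (p t₀) hpos s hs).scomp t₀ hp
  rw [Complex.real_smul] at h
  exact h

/-- **The value of that derivative is holomorphic in `s`** on `{1 − N < re(β₀+s)}` (★ (ii)(a) at `β₀ + 1`, whose strip is larger). [Shimura1982, §3 Thm. 3.1] -/
theorem differentiableOn_weightParamDeriv {N : ℕ} (Φ : ℂ → ℂ → ℝ → ℂ → ℂ)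
    (hΦa : ∀ (α₀ β₀ : ℂ) (p : ℝ), 0 < p → DifferentiableOn ℂ (Φ α₀ β₀ p) {s : ℂ | 1 - N < (β₀ + s).re})
    (α₀ β₀ : ℂ) {ρ : ℝ} (hρ : 0 < ρ) (p' : ℝ) :
    DifferentiableOn ℂ (fun s : ℂ => ((p' : ℝ) : ℂ) * (-(β₀ + s - 1) * Φ α₀ (β₀ + 1) ρ s)) {s : ℂ | 1 - N < (β₀ + s).re} := by
  have hsub : {s : ℂ | 1 - (N : ℝ) < (β₀ + s).re} ⊆ {s : ℂ | 1 - (N : ℝ) < (β₀ + 1 + s).re} := by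
    intro s hs
    simp only [mem_setOf_eq, add_re, one_re] at hs ⊢
    linarith
  have hlin : Differentiable ℂ (fun s : ℂ => -(β₀ + s - 1)) := (((differentiable_id).const_add β₀).sub_const 1).neg
  exact (differentiableOn_const _).mul (hlin.differentiableOn.mul ((hΦa α₀ (β₀ + 1) ρ hρ).mono hsub))

end Summit.HodgeConjecture.HodgeConjecture.Cruxes.HLiu418.K2LiuArchRayDerivLetters

end
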